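import Mathlib
import Summits.NavierStokesRegularity.NavierStokesRegularity.Theorems.FilamentSkeletonRssAnalyticStripLiaSymbolGamma
import Literature.NumberTheory.Sieve.EulerMascheroniEin

/-!
# Toward stub P3 `stub_liaSymbol` (line `child_tangent_analytic_strip`, child 28295 of `SkeletonJ1G`) —
# THE CORE INTEGRAL `E(p) = ∫₀^∞ e^{−t−p/t} dt/t` (`= 2K₀(2√p)`): `E(p) = log(1/p) − 2γ + R(p)`, `−p ≤ R(p) ≤ 2p + p log(1/p)`

Lane ns-filament-19175-p1 g12 (prover), 2026-08-28, `--supports stmt-NavierStokesRegularity-28295 --as helper`.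

With the positive-variable representation (`…LiaSymbolRep`), `𝔖(x) = 1 − C(p) − 2p·E(p)`, `p = x²/4`,
`C(p) = ∫₀^∞ e^{−t−p/t} dt`, `E(p) = ∫₀^∞ e^{−t−p/t} dt/t`.  This file proves the small-`p` expansion of `E` with an explicit
two-sided remainder (§4), from: the inversion `t ↦ 1/t` on `(0,1]` (§1, change of variables), the scaling `v ↦ pv` (§2),
`∫_p^1 du/u = log(1/p)`, the bounds `0 ≤ 1 − e^{−u} ≤ min(1,u)`, and `γ = Ein(1) − E₁(1)` (`…LiaSymbolGamma`).
Def-free (explicit integrals only).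

HONEST FRAMING: classical real analysis serving a HYPOTHETICAL filament-skeleton line on the NEGATIVE side of a MODEL
route; nothing here bears on Navier–Stokes regularity or blow-up.
-/

set_option linter.dupNamespace false

noncomputable section

namespace Summit.NavierStokesRegularity.NavierStokesRegularity.Theorems.AnalyticStripLiaSymbol

open Real Set MeasureTheory Filter Topology

/-! ## §1  Inversion: `∫_{(0,1]} e^{−p/t} dt/t = ∫_{(1,∞)} e^{−pv} dv/v` -/

/-- Change of variables `t = 1/v`: `∫_{(0,1]} e^{−p/t}/t dt = ∫_{(1,∞)} e^{−pv}/v dv`. -/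
theorem integral_Ioc_exp_neg_div_div_eq (p : ℝ) :
    ∫ t in Ioc (0:ℝ) 1, Real.exp (-(p / t)) / t = ∫ v in Ioi (1:ℝ), Real.exp (-(p * v)) / v := by
  have himage : (Inv.inv : ℝ → ℝ) '' Ioi (1:ℝ) = Ioo 0 1 := by
    rw [Set.image_inv_eq_inv, Set.inv_Ioi₀ one_pos, inv_one]
  have hderiv : ∀ x ∈ Ioi (1:ℝ), HasDerivWithinAt (Inv.inv : ℝ → ℝ) (-(x ^ 2)⁻¹) (Ioi 1) x := by
    intro x hx
    exact (hasDerivAt_inv (by linarith [mem_Ioi.mp hx] : x ≠ 0)).hasDerivWithinAt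
  have hinj : InjOn (Inv.inv : ℝ → ℝ) (Ioi 1) := inv_injective.injOn
  have key := integral_image_eq_integral_abs_deriv_smul measurableSet_Ioi hderiv hinj
    (fun t : ℝ => Real.exp (-(p / t)) / t)
  rw [himage] at key
  rw [← setIntegral_congr_set Ioo_ae_eq_Ioc, key]
  refine setIntegral_congr_fun measurableSet_Ioi (fun x hx => ?_)
  have hx0 : 0 < x := by linarith [mem_Ioi.mp hx]
  simp only [smul_eq_mul, abs_neg, abs_inv, abs_pow, abs_of_pos hx0, div_inv_eq_mul]
  field_simp

/-! ## §2  Scaling: `∫_{(1,∞)} e^{−pv} dv/v = ∫_{(p,∞)} e^{−u} du/u` -/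

/-- Scaling `u = pv`: `∫_{(1,∞)} e^{−pv}/v dv = ∫_{(p,∞)} e^{−u}/u du` for `p > 0`. -/
theorem integral_Ioi_exp_neg_mul_div_eq {p : ℝ} (hp : 0 < p) :
    ∫ v in Ioi (1:ℝ), Real.exp (-(p * v)) / v = ∫ u in Ioi p, Real.exp (-u) / u := by
  have key := integral_comp_mul_left_Ioi (fun u : ℝ => Real.exp (-u) / u) 1 hp
  simp only [mul_one, smul_eq_mul] at key
  have hpt : ∀ v ∈ Ioi (1:ℝ), Real.exp (-(p * v)) / v = p * (Real.exp (-(p * v)) / (p * v)) := by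
    intro v hv
    have hv0 : v ≠ 0 := by linarith [mem_Ioi.mp hv]
    field_simp
  rw [setIntegral_congr_fun measurableSet_Ioi hpt, integral_const_mul, key, ← mul_assoc,
    mul_inv_cancel₀ hp.ne', one_mul]

/-! ## §3  Integrability bookkeeping -/

/- `e^{−u}/u` is integrable on `(a, ∞)` for `a > 0`: `Literature.NumberTheory.Sieve.integrableOn_exp_neg_div_Ioi`
(reused, not restated). -/

/-- `(1 − e^{−u})/u` is integrable on `(0, a]` (bounded by `1`). -/
theorem integrableOn_one_sub_exp_div_Ioc (a : ℝ) :
    IntegrableOn (fun u : ℝ => (1 - Real.exp (-u)) / u) (Ioc 0 a) := by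
  refine IntegrableOn.of_bound (by simp) ?_ 1 ?_
  · exact (((continuous_const.sub (Real.continuous_exp.comp continuous_neg)).measurable).div
      measurable_id).aestronglyMeasurable
  · rw [ae_restrict_iff' measurableSet_Ioc]
    refine Filter.Eventually.of_forall fun t ht => ?_
    rw [Real.norm_eq_abs, abs_div, abs_of_nonneg (by nlinarith [Real.exp_le_one_iff.mpr (neg_nonpos.mpr ht.1.le)]
      : (0:ℝ) ≤ 1 - Real.exp (-t)), abs_of_pos ht.1, div_le_one ht.1]
    linarith [Real.add_one_le_exp (-t)]

/-- Pointwise: `0 ≤ (1 − e^{−u})/u ≤ 1` for `u > 0`. -/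
theorem one_sub_exp_div_mem {u : ℝ} (hu : 0 < u) :
    0 ≤ (1 - Real.exp (-u)) / u ∧ (1 - Real.exp (-u)) / u ≤ 1 := by
  have h1 : 0 ≤ 1 - Real.exp (-u) := by nlinarith [Real.exp_le_one_iff.mpr (neg_nonpos.mpr hu.le)]
  have h2 : 1 - Real.exp (-u) ≤ u := by linarith [Real.add_one_le_exp (-u)]
  exact ⟨div_nonneg h1 hu.le, (div_le_one hu).mpr h2⟩

/-- `Ein(p) = ∫₀^p (1−e^{−u})/u du ∈ [0, p]` for `p ≥ 0`. -/
theorem Ein_mem {p : ℝ} (hp : 0 ≤ p) :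
    0 ≤ ∫ u in Ioc (0:ℝ) p, (1 - Real.exp (-u)) / u ∧ ∫ u in Ioc (0:ℝ) p, (1 - Real.exp (-u)) / u ≤ p := by
  constructor
  · refine setIntegral_nonneg measurableSet_Ioc fun u hu => (one_sub_exp_div_mem hu.1).1
  · have hc : IntegrableOn (fun _ : ℝ => (1:ℝ)) (Ioc (0:ℝ) p) := integrableOn_const (hs := measure_Ioc_lt_top.ne)
    have := setIntegral_mono_on (integrableOn_one_sub_exp_div_Ioc p) hc measurableSet_Ioc
      (fun u hu => (one_sub_exp_div_mem hu.1).2)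
    simpa [hp] using this


/-- `e^{−p/t}/t ≤ 1/p` for `t, p > 0` (from `1 + y ≤ e^y`). -/
theorem exp_neg_div_div_le {p t : ℝ} (hp : 0 < p) (ht : 0 < t) : Real.exp (-(p / t)) / t ≤ 1 / p := by
  have h1 : p / t ≤ Real.exp (p / t) := by linarith [Real.add_one_le_exp (p / t)]
  rw [Real.exp_neg, div_le_div_iff₀ (by positivity) hp]
  have hpt : 0 < p / t := div_pos hp ht
  calc (Real.exp (p / t))⁻¹ * p = p / Real.exp (p / t) := by ring
    _ ≤ p / (p / t) := by gcongr
    _ = 1 * t := by field_simp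

/-- `e^{−p/t}/t` is integrable on `(0, 1]` for `p > 0`. -/
theorem integrableOn_exp_neg_div_div_Ioc {p : ℝ} (hp : 0 < p) :
    IntegrableOn (fun t : ℝ => Real.exp (-(p / t)) / t) (Ioc 0 1) := by
  refine IntegrableOn.of_bound (by simp) ?_ (1 / p) ?_
  · exact (((Real.measurable_exp.comp (measurable_const.div measurable_id).neg)).div
      measurable_id).aestronglyMeasurable
  · rw [ae_restrict_iff' measurableSet_Ioc]
    refine Filter.Eventually.of_forall fun t ht => ?_
    rw [Real.norm_eq_abs, abs_of_nonneg (div_nonneg (Real.exp_pos _).le ht.1.le)]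
    exact exp_neg_div_div_le hp ht.1

/-- `(1 − e^{−t}) e^{−p/t}/t` is integrable on `(0, 1]` (bounded by `1`) for `p ≥ 0`. -/
theorem integrableOn_one_sub_exp_mul_exp_neg_div_Ioc {p : ℝ} (hp : 0 ≤ p) :
    IntegrableOn (fun t : ℝ => (1 - Real.exp (-t)) * Real.exp (-(p / t)) / t) (Ioc 0 1) := by
  refine IntegrableOn.of_bound (by simp) ?_ 1 ?_
  · exact ((((continuous_const.sub (Real.continuous_exp.comp continuous_neg)).measurable).mul
      (Real.measurable_exp.comp (measurable_const.div measurable_id).neg)).div measurable_id).aestronglyMeasurable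
  · rw [ae_restrict_iff' measurableSet_Ioc]
    refine Filter.Eventually.of_forall fun t ht => ?_
    have h := one_sub_exp_div_mem ht.1
    have he : Real.exp (-(p / t)) ≤ 1 := by
      rw [Real.exp_le_one_iff]; exact neg_nonpos.mpr (div_nonneg hp ht.1.le)
    rw [Real.norm_eq_abs, abs_of_nonneg (by rw [mul_div_right_comm]; exact mul_nonneg h.1 (Real.exp_pos _).le),
      mul_div_right_comm]
    calc (1 - Real.exp (-t)) / t * Real.exp (-(p / t)) ≤ 1 * 1 :=
          mul_le_mul h.2 he (Real.exp_pos _).le zero_le_one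
      _ = 1 := one_mul _

/-- `e^{−t} e^{−p/t}/t` is integrable on `(1, ∞)` (`≤ e^{−t}` there) for `p ≥ 0`. -/
theorem integrableOn_exp_mul_exp_neg_div_Ioi_one {p : ℝ} (hp : 0 ≤ p) :
    IntegrableOn (fun t : ℝ => Real.exp (-t) * Real.exp (-(p / t)) / t) (Ioi 1) := by
  refine (integrableOn_exp_neg_Ioi 1).mono' ?_ ?_
  · exact (((Real.measurable_exp.comp measurable_neg).mul
      (Real.measurable_exp.comp (measurable_const.div measurable_id).neg)).div measurable_id).aestronglyMeasurable
  · rw [ae_restrict_iff' measurableSet_Ioi]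
    refine Filter.Eventually.of_forall fun t (ht : 1 < t) => ?_
    have ht0 : 0 < t := by linarith
    have he : Real.exp (-(p / t)) ≤ 1 := by rw [Real.exp_le_one_iff]; exact neg_nonpos.mpr (div_nonneg hp ht0.le)
    rw [Real.norm_eq_abs, abs_of_nonneg (by positivity)]
    calc Real.exp (-t) * Real.exp (-(p / t)) / t ≤ Real.exp (-t) * 1 / 1 := by
          gcongr
      _ = Real.exp (-t) := by ring

/-! ## §4  The decomposition of `E(p)` and its two-sided bound -/

/-- The `(0,1]`-tail integral in closed form:
`∫_{(0,1]} e^{−p/t}/t dt = log(1/p) − (Ein(1) − Ein(p)) + E₁(1)` for `0 < p ≤ 1`. -/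
theorem integral_Ioc_exp_neg_div_div_eq_log {p : ℝ} (hp : 0 < p) (hp1 : p ≤ 1) :
    ∫ t in Ioc (0:ℝ) 1, Real.exp (-(p / t)) / t
      = -Real.log p - ((∫ u in Ioc (0:ℝ) 1, (1 - Real.exp (-u)) / u) - ∫ u in Ioc (0:ℝ) p, (1 - Real.exp (-u)) / u)
        + ∫ u in Ioi (1:ℝ), Real.exp (-u) / u := by
  rw [integral_Ioc_exp_neg_div_div_eq, integral_Ioi_exp_neg_mul_div_eq hp]
  -- split `(p, ∞) = (p, 1] ∪ (1, ∞)`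
  have hI : IntegrableOn (fun u : ℝ => Real.exp (-u) / u) (Ioi p) := Literature.NumberTheory.Sieve.integrableOn_exp_neg_div_Ioi hp
  rw [← Ioc_union_Ioi_eq_Ioi hp1, setIntegral_union (Set.Ioc_disjoint_Ioi le_rfl) measurableSet_Ioi
    (hI.mono_set Ioc_subset_Ioi_self) (hI.mono_set (Ioi_subset_Ioi hp1))]
  -- `∫_{(p,1]} e^{−u}/u = ∫_{(p,1]} 1/u − ∫_{(p,1]} (1−e^{−u})/u`
  have hinv : IntegrableOn (fun u : ℝ => u⁻¹) (Ioc p 1) := by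
    rw [← intervalIntegrable_iff_integrableOn_Ioc_of_le hp1]
    exact intervalIntegral.intervalIntegrable_inv (fun u hu => by
      rw [uIcc_of_le hp1] at hu
      exact (hp.trans_le hu.1).ne') continuousOn_id
  have hEin : IntegrableOn (fun u : ℝ => (1 - Real.exp (-u)) / u) (Ioc p 1) :=
    (integrableOn_one_sub_exp_div_Ioc 1).mono_set (Ioc_subset_Ioc hp.le le_rfl)
  have hsplit : ∫ u in Ioc p 1, Real.exp (-u) / u
      = (∫ u in Ioc p 1, u⁻¹) - ∫ u in Ioc p 1, (1 - Real.exp (-u)) / u := by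
    rw [← integral_sub hinv hEin]
    refine setIntegral_congr_fun measurableSet_Ioc (fun u hu => ?_)
    have hu0 : u ≠ 0 := (hp.trans_le' le_rfl |>.trans hu.1).ne'
    field_simp
    ring
  have hlog : ∫ u in Ioc p 1, u⁻¹ = -Real.log p := by
    rw [← intervalIntegral.integral_of_le hp1, integral_inv (by
      rw [uIcc_of_le hp1]; exact fun h => (lt_irrefl (0:ℝ)) (hp.trans_le h.1))]
    rw [one_div, Real.log_inv]
  -- `∫_{(p,1]} (1−e^{−u})/u = Ein(1) − Ein(p)`
  have hEin2 : ∫ u in Ioc p 1, (1 - Real.exp (-u)) / u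
      = (∫ u in Ioc (0:ℝ) 1, (1 - Real.exp (-u)) / u) - ∫ u in Ioc (0:ℝ) p, (1 - Real.exp (-u)) / u := by
    have := setIntegral_union (Set.Ioc_disjoint_Ioc_of_le (le_refl p)) measurableSet_Ioc
      ((integrableOn_one_sub_exp_div_Ioc 1).mono_set (Ioc_subset_Ioc le_rfl hp1))
      ((integrableOn_one_sub_exp_div_Ioc 1).mono_set (Ioc_subset_Ioc hp.le le_rfl))
    rw [Ioc_union_Ioc_eq_Ioc hp.le hp1] at this
    linarith
  rw [hsplit, hlog, hEin2]

/-- **THE TWO-SIDED EXPANSION OF `E(p)`**: for `0 < p ≤ 1`,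
`−log p − 2γ − p ≤ ∫₀^∞ e^{−t} e^{−p/t} dt/t ≤ −log p − 2γ + 2p + p·(−log p)`. -/
theorem E_bounds {p : ℝ} (hp : 0 < p) (hp1 : p ≤ 1) :
    -Real.log p - 2 * Real.eulerMascheroniConstant - p
        ≤ ∫ t in Ioi (0:ℝ), Real.exp (-t) * Real.exp (-(p / t)) / t
      ∧ ∫ t in Ioi (0:ℝ), Real.exp (-t) * Real.exp (-(p / t)) / t
        ≤ -Real.log p - 2 * Real.eulerMascheroniConstant + 2 * p + p * (-Real.log p) := by
  have hL : 0 ≤ -Real.log p := by rw [neg_nonneg]; exact Real.log_nonpos hp.le hp1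
  -- the pieces
  have hV1 : IntegrableOn (fun t : ℝ => Real.exp (-(p / t)) / t) (Ioc 0 1) := integrableOn_exp_neg_div_div_Ioc hp
  have hA : IntegrableOn (fun t : ℝ => (1 - Real.exp (-t)) * Real.exp (-(p / t)) / t) (Ioc 0 1) :=
    integrableOn_one_sub_exp_mul_exp_neg_div_Ioc hp.le
  have hU : IntegrableOn (fun t : ℝ => Real.exp (-t) * Real.exp (-(p / t)) / t) (Ioi 1) :=
    integrableOn_exp_mul_exp_neg_div_Ioi_one hp.le
  have hV : IntegrableOn (fun t : ℝ => Real.exp (-t) * Real.exp (-(p / t)) / t) (Ioc 0 1) := by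
    refine (hV1.sub hA).congr_fun (fun t ht => ?_) measurableSet_Ioc
    simp only [Pi.sub_apply]
    ring
  -- split `(0,∞) = (0,1] ∪ (1,∞)`
  have hsplit : ∫ t in Ioi (0:ℝ), Real.exp (-t) * Real.exp (-(p / t)) / t
      = (∫ t in Ioc (0:ℝ) 1, Real.exp (-t) * Real.exp (-(p / t)) / t)
        + ∫ t in Ioi (1:ℝ), Real.exp (-t) * Real.exp (-(p / t)) / t := by
    rw [← setIntegral_union (Set.Ioc_disjoint_Ioi le_rfl) measurableSet_Ioi hV hU,
      Ioc_union_Ioi_eq_Ioi zero_le_one]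
  -- `V = T1 − A′`
  have hVeq : ∫ t in Ioc (0:ℝ) 1, Real.exp (-t) * Real.exp (-(p / t)) / t
      = (∫ t in Ioc (0:ℝ) 1, Real.exp (-(p / t)) / t)
        - ∫ t in Ioc (0:ℝ) 1, (1 - Real.exp (-t)) * Real.exp (-(p / t)) / t := by
    rw [← integral_sub hV1 hA]
    refine setIntegral_congr_fun measurableSet_Ioc (fun t ht => ?_)
    ring
  have hT1 := integral_Ioc_exp_neg_div_div_eq_log hp hp1
  -- `A′ ∈ [Ein(1) − (p + p·(−log p)), Ein(1)]`
  have hA_le : ∫ t in Ioc (0:ℝ) 1, (1 - Real.exp (-t)) * Real.exp (-(p / t)) / t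
      ≤ ∫ u in Ioc (0:ℝ) 1, (1 - Real.exp (-u)) / u := by
    refine setIntegral_mono_on hA (integrableOn_one_sub_exp_div_Ioc 1) measurableSet_Ioc (fun t ht => ?_)
    have h := one_sub_exp_div_mem ht.1
    have he : Real.exp (-(p / t)) ≤ 1 := by
      rw [Real.exp_le_one_iff]; exact neg_nonpos.mpr (div_nonneg hp.le ht.1.le)
    calc (1 - Real.exp (-t)) * Real.exp (-(p / t)) / t = (1 - Real.exp (-t)) / t * Real.exp (-(p / t)) := by ring
      _ ≤ (1 - Real.exp (-t)) / t * 1 := mul_le_mul_of_nonneg_left he h.1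
      _ = (1 - Real.exp (-t)) / t := mul_one _
  have hA_ge : (∫ u in Ioc (0:ℝ) 1, (1 - Real.exp (-u)) / u) - (p + p * (-Real.log p))
      ≤ ∫ t in Ioc (0:ℝ) 1, (1 - Real.exp (-t)) * Real.exp (-(p / t)) / t := by
    -- `Ein(1) − A′ = ∫_{(0,1]} (1−e^{−t})(1−e^{−p/t})/t ≤ p + p·log(1/p)`
    have hD : IntegrableOn (fun t : ℝ => (1 - Real.exp (-t)) / t - (1 - Real.exp (-t)) * Real.exp (-(p / t)) / t)
        (Ioc 0 1) := (integrableOn_one_sub_exp_div_Ioc 1).sub hA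
    have hdiff : (∫ u in Ioc (0:ℝ) 1, (1 - Real.exp (-u)) / u)
        - (∫ t in Ioc (0:ℝ) 1, (1 - Real.exp (-t)) * Real.exp (-(p / t)) / t)
        = ∫ t in Ioc (0:ℝ) 1, ((1 - Real.exp (-t)) / t - (1 - Real.exp (-t)) * Real.exp (-(p / t)) / t) :=
      (integral_sub (integrableOn_one_sub_exp_div_Ioc 1) hA).symm
    -- pointwise facts
    have hpt : ∀ t : ℝ, 0 < t → (1 - Real.exp (-t)) / t - (1 - Real.exp (-t)) * Real.exp (-(p / t)) / t
        = (1 - Real.exp (-t)) / t * (1 - Real.exp (-(p / t))) := by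
      intro t ht; ring
    have h1mexp : ∀ t : ℝ, 0 < t → 0 ≤ 1 - Real.exp (-(p / t)) ∧ 1 - Real.exp (-(p / t)) ≤ 1
        ∧ 1 - Real.exp (-(p / t)) ≤ p / t := by
      intro t ht
      refine ⟨?_, ?_, ?_⟩
      · have : Real.exp (-(p / t)) ≤ 1 := by
          rw [Real.exp_le_one_iff]; exact neg_nonpos.mpr (div_nonneg hp.le ht.le)
        linarith
      · linarith [Real.exp_pos (-(p / t))]
      · linarith [Real.add_one_le_exp (-(p / t))]
    -- split `(0,1] = (0,p] ∪ (p,1]`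
    have hsplit2 : ∫ t in Ioc (0:ℝ) 1, ((1 - Real.exp (-t)) / t - (1 - Real.exp (-t)) * Real.exp (-(p / t)) / t)
        = (∫ t in Ioc (0:ℝ) p, ((1 - Real.exp (-t)) / t - (1 - Real.exp (-t)) * Real.exp (-(p / t)) / t))
          + ∫ t in Ioc p 1, ((1 - Real.exp (-t)) / t - (1 - Real.exp (-t)) * Real.exp (-(p / t)) / t) := by
      rw [← setIntegral_union (Set.Ioc_disjoint_Ioc_of_le (le_refl p)) measurableSet_Ioc
        (hD.mono_set (Ioc_subset_Ioc le_rfl hp1)) (hD.mono_set (Ioc_subset_Ioc hp.le le_rfl)),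
        Ioc_union_Ioc_eq_Ioc hp.le hp1]
    -- on `(0,p]`: integrand ≤ 1
    have hI1 : ∫ t in Ioc (0:ℝ) p, ((1 - Real.exp (-t)) / t - (1 - Real.exp (-t)) * Real.exp (-(p / t)) / t) ≤ p := by
      have hc : IntegrableOn (fun _ : ℝ => (1:ℝ)) (Ioc (0:ℝ) p) := integrableOn_const (hs := measure_Ioc_lt_top.ne)
      have := setIntegral_mono_on (hD.mono_set (Ioc_subset_Ioc le_rfl hp1)) hc measurableSet_Ioc (fun t ht => by
        rw [hpt t ht.1]
        have h := one_sub_exp_div_mem ht.1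
        have h' := h1mexp t ht.1
        calc (1 - Real.exp (-t)) / t * (1 - Real.exp (-(p / t))) ≤ 1 * 1 := mul_le_mul h.2 h'.2.1 h'.1 zero_le_one
          _ = 1 := one_mul _)
      simpa [hp.le] using this
    -- on `(p,1]`: integrand ≤ p/t, and `∫_{(p,1]} p/t = p·(−log p)`
    have hI2 : ∫ t in Ioc p 1, ((1 - Real.exp (-t)) / t - (1 - Real.exp (-t)) * Real.exp (-(p / t)) / t)
        ≤ p * (-Real.log p) := by
      have hinv : IntegrableOn (fun u : ℝ => u⁻¹) (Ioc p 1) := by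
        rw [← intervalIntegrable_iff_integrableOn_Ioc_of_le hp1]
        exact intervalIntegral.intervalIntegrable_inv (fun u hu => by
          rw [uIcc_of_le hp1] at hu
          exact (hp.trans_le hu.1).ne') continuousOn_id
      have hlog : ∫ u in Ioc p 1, u⁻¹ = -Real.log p := by
        rw [← intervalIntegral.integral_of_le hp1, integral_inv (by
          rw [uIcc_of_le hp1]; exact fun h => (lt_irrefl (0:ℝ)) (hp.trans_le h.1))]
        rw [one_div, Real.log_inv]
      have := setIntegral_mono_on (hD.mono_set (Ioc_subset_Ioc hp.le le_rfl)) (hinv.const_mul p)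
        measurableSet_Ioc (fun t ht => by
        have ht0 : 0 < t := hp.trans ht.1
        rw [hpt t ht0]
        have h := one_sub_exp_div_mem ht0
        have h' := h1mexp t ht0
        calc (1 - Real.exp (-t)) / t * (1 - Real.exp (-(p / t))) ≤ 1 * (p / t) := mul_le_mul h.2 h'.2.2 h'.1 zero_le_one
          _ = p * t⁻¹ := by rw [one_mul, div_eq_mul_inv])
      rw [integral_const_mul, hlog] at this
      exact this
    rw [sub_le_comm, hdiff, hsplit2]
    linarith
  -- `U ∈ [E₁(1) − p, E₁(1)]`
  have hE1 : IntegrableOn (fun u : ℝ => Real.exp (-u) / u) (Ioi 1) := Literature.NumberTheory.Sieve.integrableOn_exp_neg_div_Ioi one_pos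
  have hU_le : ∫ t in Ioi (1:ℝ), Real.exp (-t) * Real.exp (-(p / t)) / t ≤ ∫ u in Ioi (1:ℝ), Real.exp (-u) / u := by
    refine setIntegral_mono_on hU hE1 measurableSet_Ioi (fun t (ht : 1 < t) => ?_)
    have ht0 : 0 < t := by linarith
    have he : Real.exp (-(p / t)) ≤ 1 := by rw [Real.exp_le_one_iff]; exact neg_nonpos.mpr (div_nonneg hp.le ht0.le)
    calc Real.exp (-t) * Real.exp (-(p / t)) / t ≤ Real.exp (-t) * 1 / t := by gcongr
      _ = Real.exp (-t) / t := by rw [mul_one]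
  have hU_ge : (∫ u in Ioi (1:ℝ), Real.exp (-u) / u) - p ≤ ∫ t in Ioi (1:ℝ), Real.exp (-t) * Real.exp (-(p / t)) / t := by
    have hlow : IntegrableOn (fun t : ℝ => Real.exp (-t) / t - p * Real.exp (-t)) (Ioi 1) :=
      hE1.sub ((integrableOn_exp_neg_Ioi 1).const_mul p)
    have h1 := setIntegral_mono_on hlow hU measurableSet_Ioi (fun t (ht : 1 < t) => by
      have ht0 : 0 < t := by linarith
      have he : 1 - p / t ≤ Real.exp (-(p / t)) := by linarith [Real.add_one_le_exp (-(p / t))]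
      have hpt2 : p / t / t ≤ p := by
        have htt : 1 ≤ t * t := one_le_mul_of_one_le_of_one_le ht.le ht.le
        rw [div_div, div_le_iff₀ (by positivity)]; nlinarith
      calc Real.exp (-t) / t - p * Real.exp (-t) ≤ Real.exp (-t) / t - (p / t / t) * Real.exp (-t) := by
            gcongr
        _ = Real.exp (-t) * (1 - p / t) / t := by field_simp
        _ ≤ Real.exp (-t) * Real.exp (-(p / t)) / t := by gcongr)
    rw [integral_sub hE1 ((integrableOn_exp_neg_Ioi 1).const_mul p), integral_const_mul,
      integral_exp_neg_Ioi] at h1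
    have hexp : Real.exp (-(1:ℝ)) ≤ 1 := Real.exp_le_one_iff.mpr (by norm_num)
    nlinarith [hp]
  -- assemble with `γ = Ein(1) − E₁(1)`
  have hγ := eulerMascheroni_eq_Ein_sub_E1
  have hEin := Ein_mem hp.le
  rw [hsplit, hVeq, hT1]
  constructor
  · nlinarith [hEin.1]
  · nlinarith [hEin.2]

end Summit.NavierStokesRegularity.NavierStokesRegularity.Theorems.AnalyticStripLiaSymbol
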